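import Summits.CriticalPhenomena.PercolationContinuityZ3.Theorems.Transplant.FKConnectivityAllQClusterDomAssoc
import Summits.CriticalPhenomena.PercolationContinuityZ3.Theorems.PercNearOneGluingNoHeavyLowerTailFKHullPortTASections
import HarnessLib

/-!
# Connectivity correlation inequalities for `φ_{w,q}`, every `q > 0` — the EXCHANGE INEQUALITY at a vertex (conjecture node K₀)
# IMPLIES cluster dominance across an adjacent edge (MM), hence CA, the hub inequality and adjacent-edge negative correlation

Support file (`--supports stmt-CriticalPhenomena-4575`), FK sub-lane `prim-bschramm-fk-1` (gen 8) of the post-continuity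
programme; builds on p205010 (kernel theorem, internal audit signed; external expert review pending).  Definitions
(`ExchangeAdjOn/FK`, the `@[conjecture]` node `ExchangeAdjFKPos` — NOT asserted), no named facts, no sorries; standard axioms.

FINDING OF THIS SEAT (bschramm/FROM-fk-1-g8-*.md).  Expanding MM for the pair `f = xz` along a second pair `g`
(one-point decomposition in both states of `f`) gives, with `w_{ab} = w[f↦a][g↦b]`, `Z_{ab}` the partition functions and
`u_{ab} = φ_{w_{ab}}(C_x ∈ 𝒰)`:
`(φ_{w[f↦1]} − φ_{w[f↦0]})(C_x ∈ 𝒰) ∝ p²Z₁₁Z₀₁(u₁₁−u₀₁) + (1−p)²Z₁₀Z₀₀(u₁₀−u₀₀) + p(1−p)·[Z₁₁Z₀₀(u₁₁−u₀₀) − Z₁₀Z₀₁(u₀₁−u₁₀)]`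
(`p = w(g)`).  The first two brackets are MM for the revealed vectors `w[g↦1]`, `w[g↦0]`; the mixed bracket is the
**exchange inequality K₀**: `Z₁₀Z₀₁(u₀₁ − u₁₀) ≤ Z₁₁Z₀₀(u₁₁ − u₀₀)` — equivalently, for two independent replicas that DISAGREE on
both `f` and `g`, the replica in which `f` is open has the stochastically larger cluster at `x`; or
`Cov(1_𝒰, J_f | J_g = 1) + Cov(1_𝒰, J_f | J_g = 0) ≥ [φ(J_f | ¬J_g) − φ(J_f | J_g)]·[φ(𝒰 | J_g) − φ(𝒰 | ¬J_g)]`.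
So **K₀ (for pairs `g` meeting the weight-1 cluster of `x`) ⇒ MM** by induction on the number of undetermined pairs
(`clusterDomAdjOn_of_exchangeAdjOn`), and with the companion files ⇒ CA, the hub inequality (13) of Ayyer–Linusson–Ravichandran and
adjacent-edge negative correlation for every `q ∈ (0,1)` (`hubFKPos_of_exchangeAdjFKPos`, `edgeNegCorrAdjFKLtOne_of_exchangeAdjFKPos`).
At `q = 1` all four `Z_{ab}` coincide and K₀ is monotonicity in `f` (`exchangeAdjOn_one`); for every `q ≥ 1` it holds by FKG
(`exchangeAdjOn_of_one_le`, `…ExchangeOneLe.lean`).  STATUS FOR `q < 1` (updated 2026-08-21T07:30Z): the node `ExchangeAdjFKPos`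
(∀ q > 0) is **REFUTED** — `not_exchangeAdjFKPos` (`…ExchangeCex.lean`): `K₄` minus an edge, `q = 1/100`, parameters of order `q`
(the arboreal-gas regime, where the `q ↓ 0` limit of K₀ is a FALSE inequality between weighted spanning-forest counts).  For moderate `q`
K₀ is census-clean: exhaustive `n ≤ 6` (all 26,704+ labelled connected graphs rooted at `0`, weights `{½, random}`,
`q ∈ {1/10, 1/2, 9/10, 1, 2}`, all up-sets): 0 violations in 1,511,720 instances with `g` at `x` and 2,173,150 with `g` off `x`
(kit j120363–66); random `n ≤ 8`: 0/2,000 per `q`.  The refinement with THREE pairs at `x` held disagreeing fails (268/521,520 at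
`q = 1/10`) and the fiberwise form is g7's false 'coefficientwise MM'.  So the implication `K₀ ⇒ MM` below cannot be fed for all `q`;
MM itself (`ClusterDomAdjFKPos`) survives every census including the arboreal regime (bschramm/FROM-fk-1-g8-EXCHANGE.md §3.5).
[cite: Grimmett2006, Thm. (3.7) (p. 39); Thm. (3.21) (p. 43); §3.9 (pp. 63–65)] [cite: Wagner2006, Conj. 5.3, Ex. 5.2 (p. 13)]
[cite: AyyerLinussonRavichandran2025, §7 eq. (13), Conj. 7.1 (p. 22)]
-/

noncomputable section

namespace Summit.CriticalPhenomena.PercolationContinuityZ3.Theorems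

namespace FK

open MeasureTheory Set Literature.Probability.LatticeModels Literature.Probability.Percolation
open scoped Classical
open BHK2006 DecisionTree HullPort

variable {V : Type*} [Fintype V]

/-! ### The node -/

/-- **K₀ — the exchange inequality at a vertex, on the vertex type `V`.**  For weights `w`, vertices `x, z`, a pair `g = vb` with `v`
joined to `x` by parameter-1 pairs of `w[xz ↦ 0]` (so `g` is a pair AT the weight-1 cluster of `x`; `v = x` allowed), and an up-set `𝒰`:
with `w_{ab} := w[xz ↦ a][g ↦ b]`, `Z_{ab}` the free partition functions and `u_{ab} := φ_{w_{ab},q}(C_x ∈ 𝒰)`,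
`Z₁₀·Z₀₁·(u₀₁ − u₁₀) ≤ Z₁₁·Z₀₀·(u₁₁ − u₀₀)`.  Holds for every `q ≥ 1` (`exchangeAdjOn_one`, `exchangeAdjOn_of_one_le`); FALSE for
small `q` (`not_exchangeAdjFKPos`, `…ExchangeCex.lean`); implies MM where it holds (`clusterDomAdjOn_of_exchangeAdjOn`).
[cite: Grimmett2006, Thm. (3.7) (p. 39); §3.9 (p. 63)] -/
def ExchangeAdjOn (V : Type*) [Fintype V] (q : ℝ) : Prop :=
  ∀ (w : Sym2 V → unitInterval) (x z v b : V) (𝒰 : Set (Set V)), IsUpperSet 𝒰 →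
    (openGraph (oneSet (Function.update w s(x, z) 0))).Reachable x v →
    rcPartitionFunctionW (Function.update (Function.update w s(x, z) 1) s(v, b) 0) q ∅ *
        rcPartitionFunctionW (Function.update (Function.update w s(x, z) 0) s(v, b) 1) q ∅ *
        ((rcMeasureW (Function.update (Function.update w s(x, z) 0) s(v, b) 1) q ∅).real (clusterIn x 𝒰) -
          (rcMeasureW (Function.update (Function.update w s(x, z) 1) s(v, b) 0) q ∅).real (clusterIn x 𝒰)) ≤
      rcPartitionFunctionW (Function.update (Function.update w s(x, z) 1) s(v, b) 1) q ∅ *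
        rcPartitionFunctionW (Function.update (Function.update w s(x, z) 0) s(v, b) 0) q ∅ *
        ((rcMeasureW (Function.update (Function.update w s(x, z) 1) s(v, b) 1) q ∅).real (clusterIn x 𝒰) -
          (rcMeasureW (Function.update (Function.update w s(x, z) 0) s(v, b) 0) q ∅).real (clusterIn x 𝒰))

/-- K₀ on every `Fin n`. [cite: Grimmett2006, §3.9 (p. 63)] -/
def ExchangeAdjFK (q : ℝ) : Prop := ∀ n : ℕ, ExchangeAdjOn (Fin n) q

/-- **K₀ for every `q > 0`.**  CONJECTURE-SHAPED STATEMENT, NOT asserted — and REFUTED the same day: `not_exchangeAdjFKPos`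
(`…ExchangeCex.lean`, `q = 1/100`); true for `q ≥ 1` (`…ExchangeOneLe.lean`).  Kept as the named hypothesis of the reduction
`clusterDomAdjFKPos_of_exchangeAdjFKPos` (⇒ MM ⇒ `ClusterAssocFKPos`, `HubFKPos`, `EdgeNegCorrAdjFKLtOne`, `HubCovBoundFKLtOne`).
[cite: Grimmett2006, §3.9 (pp. 63–65)] [cite: Wagner2006, Conj. 5.3 (p. 13)] [cite: AyyerLinussonRavichandran2025, §7 eq. (13), Conj. 7.1 (p. 22)] -/
@[conjecture] def ExchangeAdjFKPos : Prop := ∀ q : ℝ, 0 < q → ExchangeAdjFK q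

/-! ### Mass splitting along one pair -/

/-- **Mass splitting**: `Z_w·φ_w(A) = w(g)·Z_{w[g↦1]}·φ_{w[g↦1]}(A) + (1−w(g))·Z_{w[g↦0]}·φ_{w[g↦0]}(A)` (`q > 0`).
[cite: Grimmett2006, Thm. (3.7) (p. 39)] -/
theorem mass_split (w : Sym2 V → unitInterval) {q : ℝ} (hq : 0 < q) (g : Sym2 V) (A : Set (BondConfig V)) :
    rcPartitionFunctionW w q ∅ * (rcMeasureW w q ∅).real A =
      (w g : ℝ) * (rcPartitionFunctionW (Function.update w g 1) q ∅ * (rcMeasureW (Function.update w g 1) q ∅).real A) +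
      (1 - (w g : ℝ)) * (rcPartitionFunctionW (Function.update w g 0) q ∅ * (rcMeasureW (Function.update w g 0) q ∅).real A) := by
  have hmass : ∀ u : Sym2 V → unitInterval, rcPartitionFunctionW u q ∅ * (rcMeasureW u q ∅).real A =
      ∑ ω : BondConfig V, rcWeightW u q ∅ ω * ind A ω := by
    intro u
    rw [rcMeasureW_real_eq_sum_div u hq ∅ A, mul_div_cancel₀ _ (rcPartitionFunctionW_pos u hq ∅).ne']
  rw [hmass, hmass, hmass, Finset.mul_sum, Finset.mul_sum, ← Finset.sum_add_distrib]
  refine Finset.sum_congr rfl fun ω _ => ?_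
  rw [rcWeightW_affine w q ∅ g ω]
  ring

/-- Partition-function splitting: `Z_w = w(g)·Z_{w[g↦1]} + (1−w(g))·Z_{w[g↦0]}`. [cite: Grimmett2006, Thm. (3.7) (p. 39)] -/
theorem partition_split (w : Sym2 V → unitInterval) {q : ℝ} (hq : 0 < q) (g : Sym2 V) :
    rcPartitionFunctionW w q ∅ =
      (w g : ℝ) * rcPartitionFunctionW (Function.update w g 1) q ∅ + (1 - (w g : ℝ)) * rcPartitionFunctionW (Function.update w g 0) q ∅ := by
  have h := mass_split w hq g Set.univ
  haveI := isProbabilityMeasure_rcMeasureW w hq (∅ : Set V)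
  haveI := isProbabilityMeasure_rcMeasureW (Function.update w g 1) hq (∅ : Set V)
  haveI := isProbabilityMeasure_rcMeasureW (Function.update w g 0) hq (∅ : Set V)
  simp only [probReal_univ, mul_one] at h
  exact h

/-! ### The inductive step: algebra -/

/-- The two-pair expansion: MM for `f` follows from MM for the two revealed vectors and the exchange inequality.
[cite: Grimmett2006, Thm. (3.7) (p. 39)] -/
theorem mm_step {p Z₁₁ Z₁₀ Z₀₁ Z₀₀ u₁₁ u₁₀ u₀₁ u₀₀ : ℝ} (hp0 : 0 ≤ p) (hp1 : p ≤ 1)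
    (hZ₁₁ : 0 ≤ Z₁₁) (hZ₁₀ : 0 ≤ Z₁₀) (hZ₀₁ : 0 ≤ Z₀₁) (hZ₀₀ : 0 ≤ Z₀₀)
    (ih1 : u₀₁ ≤ u₁₁) (ih0 : u₀₀ ≤ u₁₀) (hK : Z₁₀ * Z₀₁ * (u₀₁ - u₁₀) ≤ Z₁₁ * Z₀₀ * (u₁₁ - u₀₀)) :
    (p * (Z₀₁ * u₀₁) + (1 - p) * (Z₀₀ * u₀₀)) * (p * Z₁₁ + (1 - p) * Z₁₀) ≤
      (p * (Z₁₁ * u₁₁) + (1 - p) * (Z₁₀ * u₁₀)) * (p * Z₀₁ + (1 - p) * Z₀₀) := by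
  have hp' : 0 ≤ 1 - p := sub_nonneg.2 hp1
  have t1 : 0 ≤ p * p * (Z₁₁ * Z₀₁ * (u₁₁ - u₀₁)) :=
    mul_nonneg (mul_nonneg hp0 hp0) (mul_nonneg (mul_nonneg hZ₁₁ hZ₀₁) (sub_nonneg.2 ih1))
  have t0 : 0 ≤ (1 - p) * (1 - p) * (Z₁₀ * Z₀₀ * (u₁₀ - u₀₀)) :=
    mul_nonneg (mul_nonneg hp' hp') (mul_nonneg (mul_nonneg hZ₁₀ hZ₀₀) (sub_nonneg.2 ih0))
  have tK : 0 ≤ p * (1 - p) * (Z₁₁ * Z₀₀ * (u₁₁ - u₀₀) - Z₁₀ * Z₀₁ * (u₀₁ - u₁₀)) :=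
    mul_nonneg (mul_nonneg hp0 hp') (sub_nonneg.2 hK)
  nlinarith [t1, t0, tK]

/-! ### K₀ ⇒ MM -/

omit [Fintype V] in
/-- `oneSet (w[f ↦ 0]) ⊆ oneSet (w[f ↦ 1])`. [folklore] -/
theorem oneSet_update_zero_subset (w : Sym2 V → unitInterval) (f : Sym2 V) :
    oneSet (Function.update w f 0) ⊆ oneSet (Function.update w f 1) := by
  intro e he
  simp only [oneSet, mem_setOf_eq] at he ⊢
  by_cases h : e = f
  · subst h; simp
  · rw [Function.update_of_ne h] at he ⊢; exact he

/-- **K₀ ⇒ MM, inductive form** (induction on the number of undetermined pairs of `w[f ↦ 0]`).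
[cite: Grimmett2006, Thm. (3.7) (p. 39); §3.9 (pp. 63–65)] -/
theorem clusterDomAdj_of_exchange_aux {q : ℝ} (hq0 : 0 < q) (hK : ExchangeAdjOn V q) :
    ∀ (n : ℕ) (w : Sym2 V → unitInterval) (x z : V), (undet (Function.update w s(x, z) 0)).card = n →
      ∀ (𝒰 : Set (Set V)), IsUpperSet 𝒰 →
        (rcMeasureW (Function.update w s(x, z) 0) q ∅).real (clusterIn x 𝒰) ≤
          (rcMeasureW (Function.update w s(x, z) 1) q ∅).real (clusterIn x 𝒰) := by
  intro n
  induction n using Nat.strong_induction_on with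
  | _ n ih =>
    intro w x z hn 𝒰 h𝒰
    by_cases hcase : ∃ g ∈ cut {x} (oneSet (Function.update w s(x, z) 0)), g ∈ undet (Function.update w s(x, z) 0)
    · obtain ⟨g, ⟨v, hvg, x', hx', hxv⟩, hgu⟩ := hcase
      rw [mem_singleton_iff] at hx'
      subst hx'
      have hg : g = s(v, Sym2.Mem.other hvg) := (Sym2.other_spec hvg).symm
      -- `g ≠ f` since `w[f ↦ 0] f = 0` is determined
      have hgf : g ≠ s(x', z) := by
        intro h
        rw [mem_undet_iff] at hgu
        apply hgu; left; rw [h]; simp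
      -- `Function.update` in the two orders agree
      have comm : ∀ (a c : unitInterval),
          Function.update (Function.update w g c) s(x', z) a = Function.update (Function.update w s(x', z) a) g c :=
        fun a c => Function.update_comm hgf c a w
      -- induction hypothesis for `w[g ↦ 1]` and `w[g ↦ 0]`
      have hlt : ∀ c : unitInterval, (c = 0 ∨ c = 1) →
          (undet (Function.update (Function.update w g c) s(x', z) 0)).card < n := by
        intro c hc
        rw [comm]
        have hsub : undet (Function.update (Function.update w s(x', z) 0) g c) ⊆
            (undet (Function.update w s(x', z) 0)).erase g := by
          intro e he
          rw [mem_undet_iff] at he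
          rw [Finset.mem_erase, mem_undet_iff]
          by_cases h : e = g
          · subst h; simp only [Function.update_self] at he; exact absurd hc he
          · rw [Function.update_of_ne h] at he; exact ⟨h, he⟩
        have h1 := Finset.card_le_card hsub
        rw [Finset.card_erase_of_mem hgu, hn] at h1
        have hpos : 0 < (undet (Function.update w s(x', z) 0)).card := Finset.card_pos.2 ⟨g, hgu⟩
        omega
      have ih1 := ih _ (hlt 1 (Or.inr rfl)) (Function.update w g 1) x' z rfl 𝒰 h𝒰
      have ih0 := ih _ (hlt 0 (Or.inl rfl)) (Function.update w g 0) x' z rfl 𝒰 h𝒰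
      rw [comm, comm] at ih1 ih0
      -- the exchange inequality
      have hKx := hK w x' z v (Sym2.Mem.other hvg) 𝒰 h𝒰 hxv
      rw [← hg] at hKx
      -- mass splitting of numerator and denominator on both sides
      have hp0 : 0 ≤ (w g : ℝ) := (w g).2.1
      have hp1 : (w g : ℝ) ≤ 1 := (w g).2.2
      have e0 := mass_split (Function.update w s(x', z) 0) hq0 g (clusterIn x' 𝒰)
      have e1 := mass_split (Function.update w s(x', z) 1) hq0 g (clusterIn x' 𝒰)
      have d0 := partition_split (Function.update w s(x', z) 0) hq0 g
      have d1 := partition_split (Function.update w s(x', z) 1) hq0 g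
      have hwg0 : ((Function.update w s(x', z) 0 g : unitInterval) : ℝ) = w g := by rw [Function.update_of_ne hgf]
      have hwg1 : ((Function.update w s(x', z) 1 g : unitInterval) : ℝ) = w g := by rw [Function.update_of_ne hgf]
      rw [hwg0] at e0 d0
      rw [hwg1] at e1 d1
      have hZ0 := rcPartitionFunctionW_pos (Function.update w s(x', z) 0) hq0 (∅ : Set V)
      have hZ1 := rcPartitionFunctionW_pos (Function.update w s(x', z) 1) hq0 (∅ : Set V)
      have step := mm_step hp0 hp1
        (rcPartitionFunctionW_pos (Function.update (Function.update w s(x', z) 1) g 1) hq0 (∅ : Set V)).le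
        (rcPartitionFunctionW_pos (Function.update (Function.update w s(x', z) 1) g 0) hq0 (∅ : Set V)).le
        (rcPartitionFunctionW_pos (Function.update (Function.update w s(x', z) 0) g 1) hq0 (∅ : Set V)).le
        (rcPartitionFunctionW_pos (Function.update (Function.update w s(x', z) 0) g 0) hq0 (∅ : Set V)).le
        ih1 ih0 hKx
      -- the mass inequality `(Z₀ φ₀) Z₁ ≤ (Z₁ φ₁) Z₀`
      have key : (rcPartitionFunctionW (Function.update w s(x', z) 0) q ∅ *
            (rcMeasureW (Function.update w s(x', z) 0) q ∅).real (clusterIn x' 𝒰)) *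
            rcPartitionFunctionW (Function.update w s(x', z) 1) q ∅ ≤
          (rcPartitionFunctionW (Function.update w s(x', z) 1) q ∅ *
            (rcMeasureW (Function.update w s(x', z) 1) q ∅).real (clusterIn x' 𝒰)) *
            rcPartitionFunctionW (Function.update w s(x', z) 0) q ∅ := by
        rw [e0, e1]
        conv_lhs => rw [d1]
        conv_rhs => rw [d0]
        exact step
      refine le_of_mul_le_mul_left ?_ (mul_pos hZ0 hZ1)
      nlinarith [key]
    · -- base case: the cluster of `x` under `w[f ↦ 0]` is deterministic, and contained in the cluster under `w[f ↦ 1]`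
      push Not at hcase
      have hA : ∀ g ∈ cut {x} (oneSet (Function.update w s(x, z) 0)),
          Function.update w s(x, z) 0 g = 0 ∨ Function.update w s(x, z) 0 g = 1 := fun g hg => by
        have := hcase g hg; rw [mem_undet_iff] at this; push Not at this; exact this
      rw [real_clusterIn_of_determined _ hq0 x hA 𝒰]
      by_cases hin : openCluster (oneSet (Function.update w s(x, z) 0)) x ∈ 𝒰
      · rw [ind_of_mem hin]
        have h1 : (rcMeasureW (Function.update w s(x, z) 1) q ∅).real (clusterIn x 𝒰) = 1 := by
          rw [real_eq_rcE_ind _ hq0, ← rcE_one (Function.update w s(x, z) 1) hq0]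
          refine rcE_congr_support _ q fun ω hω => ?_
          have hsub : oneSet (Function.update w s(x, z) 0) ⊆ ω := fun e he =>
            (mem_of_rcMass_ne_zero _ q hω).1 e (oneSet_update_zero_subset w s(x, z) he)
          have hmono : openCluster (oneSet (Function.update w s(x, z) 0)) x ⊆ openCluster ω x :=
            fun y hy => hy.mono (openGraph_le hsub)
          exact ind_of_mem (show ω ∈ clusterIn x 𝒰 from h𝒰 hmono hin)
        rw [h1]
      · rw [ind_of_not_mem hin]; exact measureReal_nonneg

/-- **K₀ ⇒ MM** on the vertex type `V` (every `q > 0`). [cite: Grimmett2006, Thm. (3.7) (p. 39); §3.9 (pp. 63–65)] -/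
theorem clusterDomAdjOn_of_exchangeAdjOn {q : ℝ} (hq0 : 0 < q) (hK : ExchangeAdjOn V q) : ClusterDomAdjOn V q :=
  fun w x z 𝒰 h𝒰 => clusterDomAdj_of_exchange_aux hq0 hK _ w x z rfl 𝒰 h𝒰

/-- `ExchangeAdjFK q → ClusterDomAdjFK q` (every `q > 0`). [cite: Grimmett2006, §3.9 (pp. 63–65)] -/
theorem clusterDomAdjFK_of_exchangeAdjFK {q : ℝ} (hq0 : 0 < q) (hK : ExchangeAdjFK q) : ClusterDomAdjFK q :=
  fun n => clusterDomAdjOn_of_exchangeAdjOn hq0 (hK n)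

/-- **Conjecture nodes: `ExchangeAdjFKPos → ClusterDomAdjFKPos`.** [cite: Grimmett2006, §3.9 (pp. 63–65)] -/
theorem clusterDomAdjFKPos_of_exchangeAdjFKPos (hK : ExchangeAdjFKPos) : ClusterDomAdjFKPos :=
  fun q hq0 => clusterDomAdjFK_of_exchangeAdjFK hq0 (hK q hq0)

/-- **`ExchangeAdjFKPos → ClusterAssocFKPos`.** [cite: AyyerLinussonRavichandran2025, §7 eq. (13), Conj. 7.1 (p. 22)] -/
theorem clusterAssocFKPos_of_exchangeAdjFKPos (hK : ExchangeAdjFKPos) : ClusterAssocFKPos :=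
  clusterAssocFKPos_of_clusterDomAdjFKPos (clusterDomAdjFKPos_of_exchangeAdjFKPos hK)

/-- **`ExchangeAdjFKPos → HubFKPos`** (Ayyer–Linusson–Ravichandran (13) for every `q > 0`).
[cite: AyyerLinussonRavichandran2025, §7 eq. (13), Conj. 7.1 (p. 22)] -/
theorem hubFKPos_of_exchangeAdjFKPos (hK : ExchangeAdjFKPos) : HubFKPos :=
  hubFKPos_of_clusterDomAdjFKPos (clusterDomAdjFKPos_of_exchangeAdjFKPos hK)

/-- **`ExchangeAdjFKPos → EdgeNegCorrAdjFKLtOne`** (adjacent-edge negative correlation for every `q ∈ (0,1)`).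
[cite: Grimmett2006, §3.9 eq. (3.94) (p. 63)] [cite: Wagner2006, Conj. 5.3 (p. 13)] -/
theorem edgeNegCorrAdjFKLtOne_of_exchangeAdjFKPos (hK : ExchangeAdjFKPos) : EdgeNegCorrAdjFKLtOne :=
  edgeNegCorrAdjFKLtOne_of_clusterDomAdjFKPos (clusterDomAdjFKPos_of_exchangeAdjFKPos hK)

/-- **`ExchangeAdjFKPos → HubCovBoundFKLtOne`.** [cite: Grimmett2006, §3.9 (pp. 63–65)] -/
theorem hubCovBoundFKLtOne_of_exchangeAdjFKPos (hK : ExchangeAdjFKPos) : HubCovBoundFKLtOne :=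
  hubCovBoundFKLtOne_of_clusterDomAdjFKPos (clusterDomAdjFKPos_of_exchangeAdjFKPos hK)

/-! ### The case `q = 1` -/

/-- **K₀ holds at `q = 1`**: all four partition functions equal `1`, and the inequality is `u₀₁ + u₀₀ ≤ u₁₁ + u₁₀`, i.e. monotonicity
of `φ_{w,1}(C_x ∈ 𝒰)` in the parameter of `f`. [cite: Grimmett2006, Thm. (3.21) (p. 43)] -/
theorem exchangeAdjOn_one : ExchangeAdjOn V 1 := by
  intro w x z v b 𝒰 h𝒰 _
  simp only [rcPartitionFunctionW_one, one_mul]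
  have hA := isUpperSet_clusterIn x h𝒰
  have m1 : (rcMeasureW (Function.update (Function.update w s(x, z) 0) s(v, b) 1) 1 ∅).real (clusterIn x 𝒰) ≤
      (rcMeasureW (Function.update (Function.update w s(x, z) 1) s(v, b) 1) 1 ∅).real (clusterIn x 𝒰) := by
    refine rcMeasureW_real_mono_weights (fun e => ?_) le_rfl ∅ hA
    by_cases h1 : e = s(v, b)
    · subst h1; simp
    · rw [Function.update_of_ne h1, Function.update_of_ne h1]
      by_cases h2 : e = s(x, z)
      · subst h2; simp
      · rw [Function.update_of_ne h2, Function.update_of_ne h2]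
  have m0 : (rcMeasureW (Function.update (Function.update w s(x, z) 0) s(v, b) 0) 1 ∅).real (clusterIn x 𝒰) ≤
      (rcMeasureW (Function.update (Function.update w s(x, z) 1) s(v, b) 0) 1 ∅).real (clusterIn x 𝒰) := by
    refine rcMeasureW_real_mono_weights (fun e => ?_) le_rfl ∅ hA
    by_cases h1 : e = s(v, b)
    · subst h1; simp
    · rw [Function.update_of_ne h1, Function.update_of_ne h1]
      by_cases h2 : e = s(x, z)
      · subst h2; simp
      · rw [Function.update_of_ne h2, Function.update_of_ne h2]
  linarith

/-- `ExchangeAdjFK 1`. [cite: Grimmett2006, Thm. (3.21) (p. 43)] -/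
theorem exchangeAdjFK_one : ExchangeAdjFK 1 := fun _ => exchangeAdjOn_one

end FK

end Summit.CriticalPhenomena.PercolationContinuityZ3.Theorems

end
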